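/-
PORT (pub-hodgecm2, COR-CM cell) of the stage-1 package file `HodgeCMPerL/HodgeCM/Proofs/Pohlmann/PohlmannEq.lean`
(pub-hodgecm HOME/lean, bytes of record md5 5c8e76b73e5f, 321 lines). Declarations VERBATIM; edits: imports rewritten to tree
modules, namespace token `HodgeCM` ↦ `Summit.HodgeConjecture.CorCM`, package `conjRingHomK` ↦ tree `Literature.NumberTheory.Automorphic.cmConjRingHom`
(definitionally equal bodies), linter fixes. Generator: pub-hodgecm2-p1 `work/port/build_kit.py`.
b06 LANE VARIANT (theorems only): `def Universe.PohlmannBasis` lives VERBATIM in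
`Summits.HodgeConjecture.CorCM.Proofs.Pohlmann.PohlmannBasisDef` (imported); every other declaration byte-identical to the kit of record #34.
-/
import Summits.HodgeConjecture.CorCM.Proofs.Pohlmann.WeightHodge
import Summits.HodgeConjecture.CorCM.Proofs.Pohlmann.PohlmannBasisDef
import Mathlib.RingTheory.Flat.Equalizer
import Mathlib.FieldTheory.Minpoly.IsConjRoot
import Mathlib.LinearAlgebra.Eigenspace.Minpoly

/-!
# Pohlmann's theorem in PRINT form: `B^p(A′) ⊗ ℂ = ⊕_{S Hodge weight} V_S`

Gao–Ullmo, *J. Inst. Math. Jussieu* 25 (2025) 215–249 = arXiv:2411.12249, Theorem 3.1 "(Pohlmann)", p. 9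
ll. 32–37, verbatim: "For each `p ≥ 0`, the vector space `B^p(A) ⊗ ℂ` has a basis consisting of `[P]` for those
ordered sets `P ∈ 𝒫(S)` with `|P| = 2p` such that `|σP ∩ Φ| = |σP ∩ Φ̄|` for all `σ ∈ G`."  (After Pohlmann,
*Ann. of Math.* 88 (1968) 161–180, Thm 1.)

The landed `Summit.HodgeConjecture.CorCM.Universe.PohlmannSpan` (`Geometry/WeightVectors.lean`) is the inclusion `⊆` of this
statement (every complexified Hodge class is a combination of weight vectors of HODGE weights), proved from the
model axioms in `Summit.HodgeConjecture.CorCM.Proofs.PohlmannSpan` (gen 1, modulo M29/M30) and `Summit.HodgeConjecture.CorCM.Proofs.Pohlmann.WeightHodge`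
(gen 2, M29/M30 discharged from the textbook facts N1–N4).  This file proves the converse inclusion `⊇` — loc. cit.
p. 9 ll. 46–47 "It remains to prove that `[P] ∈ B^p(A) ⊗ ℂ` for each `P ∈ 𝒫(S)` with `|P| = 2p` satisfying (3.1)"
— and hence the print statement in CM-algebra form:

* `Summit.HodgeConjecture.CorCM.Universe.weightSpace_le_baseChange_hodgeClassesOf` — for a Hodge weight `S`, `V_S ⊆ B^p ⊗ ℂ`;
* `Summit.HodgeConjecture.CorCM.Universe.baseChange_hodgeClassesOf_eq_iSup` — `B^p(A′) ⊗ ℂ = ⨆_{S Hodge weight} V_S`, the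
  supremum being independent (`iSupIndep_weightSpace_hodge`, from gen 2's `iSupIndep_weightSpace`), i.e. an
  internal direct sum;
* `Summit.HodgeConjecture.CorCM.Universe.PohlmannBasis` (the print statement as a `Prop`, no parity/degree restriction on `F`),
  `pohlmannBasis_holds (M) (h29) (h30)`, `pohlmannBasis_of_facts (M) (hN1) (hN2) (hN3) (hN4)`, and
  `pohlmannSpan_of_pohlmannBasis : U.PohlmannBasis → U.PohlmannSpan` (the print form refines the landed one).

Proof of `⊇` (replacing the Dedekind-determinant argument of loc. cit. ll. 46–47, `det(σ(u_j))_{σ,j} ≠ 0`, by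
rational linear algebra, as gen 1 did for `⊆`).  Let `T = Σ_i c_i M_i^*` be gen 1's RATIONAL separating operator
on `H^{2p}(A′, ℚ)` (`sepOp`; eigenvalue `λ(S')` on `V_{S'}`, `λ` injective, `λ(S) = σ₀(y)` with `y ∈ F`).  Put
`χ = minpoly_ℚ(y) ∈ ℚ[X]` and `K = ker χ(T) ⊆ H^{2p}(A′, ℚ)`, a RATIONAL subspace.  Then
(1) `K ⊗ ℂ = ker χ(T_ℂ)` (flatness of `ℂ/ℚ`, Mathlib `Module.Flat.ker_lTensor_eq`) is `T_ℂ`-stable, hence the sum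
    of its intersections with the eigenspaces `V_{S'}` (M29); if it meets `V_{S'}` then `χ(λ(S')) = 0`, so
    `λ(S') = σ₀(y')` with `y'` a root of `minpoly_ℚ(y)`, i.e. `y' = g(y)` for some `g ∈ Gal(F/ℚ)` (Mathlib
    `IsConjRoot`), so `λ(S') = λ(P·S)` for the Galois translate `P` with `P(σ₀) = σ₀ ∘ g`, so `S' = P·S` is again
    a Hodge weight and `V_{S'} ⊆ H^{p,p}` (M30).  Hence `K ⊗ ℂ ⊆ H^{p,p}`, so `K ⊆ B^p` (rational classes in
    `H^{p,p}`);
(2) `V_S ⊆ ker χ(T_ℂ) = K ⊗ ℂ ⊆ B^p ⊗ ℂ` since `χ(T_ℂ)` acts on `V_S` by `χ(σ₀ y) = σ₀(χ(y)) = 0`.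
-/

noncomputable section

open scoped TensorProduct NumberField
open Polynomial

namespace Summit.HodgeConjecture.CorCM

open Literature.AlgebraicGeometry.Motives (CMType HodgeStructure)
open Literature.AlgebraicGeometry.Motives.HodgeStructure (ofRat ofRat_apply)
open Summit.HodgeConjecture.CorCM.Pohlmann

/-! ### Linear algebra: kernels under base change, polynomials in a base-changed operator -/

namespace Pohlmann

section LinAlg

variable {K L V W : Type*} [Field K] [Field L] [Algebra K L] [AddCommGroup V] [Module K V]
  [AddCommGroup W] [Module K W]

/-- `ker (f ⊗ L) = (ker f) ⊗ L` for a field extension `L/K` (flatness; Mathlib `Module.Flat.ker_lTensor_eq`). -/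
theorem ker_baseChange_eq (f : V →ₗ[K] W) :
    LinearMap.ker (f.baseChange L) = (LinearMap.ker f).baseChange L :=
  Module.Flat.ker_lTensor_eq L L f

/-- Base change commutes with polynomial calculus: `(χ(T)) ⊗ L = χ_L(T ⊗ L)` (cf. the `K`-polynomial form
`Summit.HodgeConjecture.CorCM.Universe.baseChange_aeval` of `Proofs/Prop22/Algebraic.lean`). -/
theorem baseChange_aeval_map (T : V →ₗ[K] V) (χ : K[X]) :
    (aeval T χ).baseChange L = aeval (T.baseChange L) (χ.map (algebraMap K L)) := by
  rw [aeval_map_algebraMap]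
  exact (aeval_algHom_apply (Module.End.baseChangeHom K L V) T χ).symm

/-- A polynomial `p(f)` acts on a `μ`-eigenvector of `f` by the scalar `p(μ)`. -/
theorem aeval_apply_of_mem_eigenspace {W' : Type*} [AddCommGroup W'] [Module L W'] {f : Module.End L W'}
    {μ : L} {x : W'} (hx : x ∈ f.eigenspace μ) (p : L[X]) : aeval f p x = p.eval μ • x := by
  by_cases h0 : x = 0
  · rw [h0, map_zero, smul_zero]
  · exact Module.End.aeval_apply_of_hasEigenvector (Module.End.hasEigenvector_iff.2 ⟨hx, h0⟩)

end LinAlg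

end Pohlmann

namespace Universe

variable {U : Universe}

/-! ### Hodge weights: Galois invariance and Hodge type `(p,p)` -/

section HodgeWeights

variable {F : CMField} {n : ℕ} {Θ : Fin (n + 1) → CMType F}

/-- A Galois translate of a Hodge weight is a Hodge weight. -/
theorem isHodgeWeight_permWeight {p : ℕ} {S : Fin (n + 1) → Finset ((F : Type) →+* ℂ)}
    (hS : IsHodgeWeight Θ p S) (P : GalT F) : IsHodgeWeight Θ p (permWeight P.1 S) := by
  refine ⟨by rw [sum_card_permWeight]; exact hS.1, fun P' => ?_⟩
  rw [sum_sum_permWeight P.1 S fun j t => ind (Θ j) (P'.1 t)]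
  have h := hS.2 (P' * P)
  simpa only [GalT.mul_apply] using h

/-- For a Hodge weight `S` (in degree `2p`), `p_S = q_S = p`. -/
theorem types_of_isHodgeWeight {p : ℕ} {S : Fin (n + 1) → Finset ((F : Type) →+* ℂ)}
    (hS : IsHodgeWeight Θ p S) :
    (∑ j, ∑ s ∈ S j, ind (Θ j) s) = p ∧ (∑ j, ∑ s ∈ S j, (1 - ind (Θ j) s)) = p := by
  have hp : (∑ j, ∑ s ∈ S j, ind (Θ j) s) = p := by simpa only [GalT.one_apply] using hS.2 1
  refine ⟨hp, ?_⟩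
  have hsum : (∑ j, ∑ s ∈ S j, ind (Θ j) s) + (∑ j, ∑ s ∈ S j, (1 - ind (Θ j) s)) =
      ((∑ j, (S j).card : ℕ) : ℤ) := by
    rw [← Finset.sum_add_distrib, Nat.cast_sum]
    refine Finset.sum_congr rfl fun j _ => ?_
    rw [← Finset.sum_add_distrib, Finset.sum_congr rfl fun s _ => add_sub_cancel (ind (Θ j) s) 1]
    simp
  rw [hp, hS.1] at hsum
  push_cast at hsum
  linarith

/-- The weight space of a Hodge weight lies in `H^{p,p}` (M30). -/
theorem weightSpace_le_piece_of_isHodgeWeight (h30 : U.Fact_weightHodge) {p : ℕ}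
    {S : Fin (n + 1) → Finset ((F : Type) →+* ℂ)} (hS : IsHodgeWeight Θ p S) :
    U.weightSpace F Θ S (2 * p) ≤ (U.hodge (U.cmProd F Θ) (2 * p)).piece p p := by
  have h := h30 F n Θ (2 * p) S
  obtain ⟨hp, hq⟩ := types_of_isHodgeWeight hS
  rwa [hp, hq] at h

end HodgeWeights

/-! ### The converse inclusion `V_S ⊆ B^p ⊗ ℂ` for Hodge weights `S` -/

section Converse

variable {F : CMField} [IsGalois ℚ F] {n : ℕ} {Θ : Fin (n + 1) → CMType F} {ι : Type} [Fintype ι]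
  {j : ι → Fin (n + 1)} {a : ι → 𝓞 F} {c : ι → ℕ} {Mi : ι → U.Mor (U.cmProd F Θ) (U.cmProd F Θ)}

omit [IsGalois ℚ F] in
/-- `σ₀(χ(z)) = χ_ℂ(σ₀ z)` for a rational polynomial `χ` and an embedding `σ₀ : F → ℂ`. -/
theorem emb_aeval_eq_eval_map (σ₀ : (F : Type) →+* ℂ) (χ : ℚ[X]) (z : F) :
    σ₀ (aeval z χ) = (χ.map (algebraMap ℚ ℂ)).eval (σ₀ z) := by
  have e1 : algebraMap ℚ ℂ = σ₀.comp (algebraMap ℚ F) := Subsingleton.elim _ _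
  rw [aeval_def, hom_eval₂, ← e1, eval_map]

/-- **`⊇` of Pohlmann's theorem**: for a Hodge weight `S`, the weight space `V_S ⊆ H^{2p}(A′, ℂ)` lies in the
complexification `B^p(A′) ⊗ ℂ` of the rational Hodge classes (Gao–Ullmo 2025, proof of Thm 3.1, p. 9 ll. 46–47). -/
theorem weightSpace_le_baseChange_hodgeClassesOf (h29 : U.Fact_weightSpan) (h30 : U.Fact_weightHodge)
    (hM : ∀ i, U.IsFactorAct F Θ (j i) (a i : F) (Mi i))
    (hinj : Function.Injective (sepVal j a c)) (p : ℕ) {S : Fin (n + 1) → Finset ((F : Type) →+* ℂ)}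
    (hS : IsHodgeWeight Θ p S) :
    U.weightSpace F Θ S (2 * p) ≤ (U.hodgeClassesOf (U.cmProd F Θ) p).baseChange ℂ := by
  classical
  -- an embedding `σ₀` exists
  obtain ⟨σ₀⟩ : Nonempty ((F : Type) →+* ℂ) := by
    have hc : 0 < Fintype.card ((F : Type) →+* ℂ) := by
      rw [NumberField.Embeddings.card]; exact Module.finrank_pos
    exact Fintype.card_pos_iff.mp hc
  -- `λ(S) = σ₀ y`, `χ = minpoly y`, `Q = χ(T)`
  obtain ⟨y, hy, hPy⟩ := exists_sepVal_eq_emb σ₀ j a c S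
  set T : U.Coh (U.cmProd F Θ) (2 * p) →ₗ[ℚ] U.Coh (U.cmProd F Θ) (2 * p) := U.sepOp c Mi (2 * p) with hT
  set χ : ℚ[X] := minpoly ℚ y with hχ
  set Q : U.Coh (U.cmProd F Θ) (2 * p) →ₗ[ℚ] U.Coh (U.cmProd F Θ) (2 * p) := aeval T χ with hQ
  have hQC : Q.baseChange ℂ = aeval (T.baseChange ℂ) (χ.map (algebraMap ℚ ℂ)) :=
    baseChange_aeval_map T χ
  -- `ker Q_ℂ` is `T_ℂ`-stable
  set K' : Submodule ℂ (U.CohC (U.cmProd F Θ) (2 * p)) := LinearMap.ker (Q.baseChange ℂ) with hK'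
  have hcomm : Commute (T.baseChange ℂ) (Q.baseChange ℂ) := by
    have h := (commute_X (χ.map (algebraMap ℚ ℂ))).map (aeval (T.baseChange ℂ))
    rwa [aeval_X, ← hQC] at h
  have hK'stab : ∀ z ∈ K', T.baseChange ℂ z ∈ K' := by
    intro z hz
    rw [hK', LinearMap.mem_ker] at hz ⊢
    rw [← Module.End.mul_apply, ← hcomm.eq, Module.End.mul_apply, hz, map_zero]
  -- `ker Q_ℂ ⊆ H^{p,p}`
  have hK'le : K' ≤ (U.hodge (U.cmProd F Θ) (2 * p)).piece p p := by
    have hdec : K' = ⨆ μ, K' ⊓ Module.End.eigenspace (T.baseChange ℂ) μ := by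
      have h := Submodule.inf_iSup_genEigenspace (p := K') (f := T.baseChange ℂ) hK'stab 1
      rw [iSup_eigenspace_eq_top h29 hM (2 * p), inf_top_eq] at h
      exact h
    refine hdec.le.trans (iSup_le fun μ => ?_)
    by_cases hμ : K' ⊓ Module.End.eigenspace (T.baseChange ℂ) μ = ⊥
    · rw [hμ]; exact bot_le
    obtain ⟨z, hz, hz0⟩ := (Submodule.ne_bot_iff _).mp hμ
    obtain ⟨hzK, hzE⟩ := Submodule.mem_inf.mp hz
    -- `μ` is a root of `χ_ℂ`
    have hroot : (χ.map (algebraMap ℚ ℂ)).eval μ = 0 := by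
      have h1 : Q.baseChange ℂ z = 0 := hzK
      rw [hQC, aeval_apply_of_mem_eigenspace hzE] at h1
      exact (smul_eq_zero.mp h1).resolve_right hz0
    -- `μ = λ(S')`
    have hE : Module.End.eigenspace (T.baseChange ℂ) μ ≠ ⊥ :=
      fun h => hμ (eq_bot_iff.mpr (inf_le_right.trans h.le))
    obtain ⟨S', hS'⟩ := exists_sepVal_eq h29 hM (2 * p) hE
    -- `λ(S') = σ₀ y'` with `y'` a Galois conjugate of `y`
    obtain ⟨y', hy', -⟩ := exists_sepVal_eq_emb σ₀ j a c S'
    have hroot' : aeval y' χ = 0 := by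
      apply σ₀.injective
      rw [map_zero, emb_aeval_eq_eval_map, ← hy', hS', hroot]
    have hconj : IsConjRoot ℚ y y' := isConjRoot_of_aeval_eq_zero (IsIntegral.of_finite ℚ y) hroot'
    obtain ⟨g, hg⟩ := isConjRoot_iff_exists_algEquiv.mp hconj.symm
    -- the Galois translate `P` with `P σ₀ = σ₀ ∘ g` carries `S` to `S'`
    have hP : (translate σ₀ (σ₀.comp (g : (F : Type) →+* F))).1 σ₀ = σ₀.comp (g : (F : Type) →+* F) :=
      translate_apply_self _ _
    have hSS' : permWeight (translate σ₀ (σ₀.comp (g : (F : Type) →+* F))).1 S = S' := by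
      apply hinj
      rw [hPy _ g hP, hg, ← hy']
    -- conclude with M30 for the Hodge weight `S' = P • S`
    calc K' ⊓ Module.End.eigenspace (T.baseChange ℂ) μ
        ≤ Module.End.eigenspace (T.baseChange ℂ) μ := inf_le_right
      _ = U.weightSpace F Θ S' (2 * p) := by rw [← hS', eigenspace_eq_weightSpace h29 hM hinj (2 * p) S']
      _ ≤ (U.hodge (U.cmProd F Θ) (2 * p)).piece p p :=
          weightSpace_le_piece_of_isHodgeWeight h30 (hSS' ▸ isHodgeWeight_permWeight hS _)
  -- (1) the RATIONAL subspace `ker Q` consists of Hodge classes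
  have hK : LinearMap.ker Q ≤ U.hodgeClassesOf (U.cmProd F Θ) p := by
    intro v hv
    have hvC : ofRat v ∈ K' := by
      rw [hK', LinearMap.mem_ker, ofRat_apply, LinearMap.baseChange_tmul, LinearMap.mem_ker.mp hv,
        TensorProduct.tmul_zero]
    change ofRat v ∈ (U.hodge (U.cmProd F Θ) (2 * p)).F p
    exact HodgeStructure.piece_le_F _ _ _ (hK'le hvC)
  -- (2) `V_S ⊆ ker Q_ℂ = (ker Q) ⊗ ℂ ⊆ B ⊗ ℂ`
  intro x hx
  have hxK : x ∈ LinearMap.ker (Q.baseChange ℂ) := by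
    rw [LinearMap.mem_ker, hQC, aeval_apply_of_mem_eigenspace (weightSpace_le_eigenspace hM (2 * p) S hx),
      hy, ← emb_aeval_eq_eval_map, hχ, minpoly.aeval, map_zero, zero_smul]
  rw [ker_baseChange_eq] at hxK
  exact Submodule.baseChange_mono ℂ hK hxK

/-- **Pohlmann's theorem (print form), with a chosen separating family**: `B^p ⊗ ℂ = ⨆_{S Hodge weight} V_S`. -/
theorem baseChange_hodgeClassesOf_eq_iSup' (M : U.ModelAxioms) (h29 : U.Fact_weightSpan)
    (h30 : U.Fact_weightHodge) (hM : ∀ i, U.IsFactorAct F Θ (j i) (a i : F) (Mi i))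
    (hinj : Function.Injective (sepVal j a c)) (p : ℕ) :
    (U.hodgeClassesOf (U.cmProd F Θ) p).baseChange ℂ =
      ⨆ (S : Fin (n + 1) → Finset ((F : Type) →+* ℂ)) (_ : IsHodgeWeight Θ p S),
        U.weightSpace F Θ S (2 * p) := by
  refine le_antisymm ?_
    (iSup₂_le fun S hS => weightSpace_le_baseChange_hodgeClassesOf h29 h30 hM hinj p hS)
  refine (baseChange_hodgeClassesOf_le M h29 hM hinj p).trans (iSup₂_le fun S hS => ?_)
  exact le_iSup₂_of_le S (isHodgeWeight_of_meets M h29 h30 hM hinj p hS) le_rfl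

end Converse

/-! ### The print statement -/

section Print

variable {F : CMField} {n : ℕ} {Θ : Fin (n + 1) → CMType F}

/-- `B^p(A′) ⊗ ℂ = ⨆_{S Hodge weight} V_S` under the model axioms and M29/M30. -/
theorem baseChange_hodgeClassesOf_eq_iSup (M : U.ModelAxioms) (h29 : U.Fact_weightSpan)
    (h30 : U.Fact_weightHodge) [IsGalois ℚ F] (p : ℕ) :
    (U.hodgeClassesOf (U.cmProd F Θ) p).baseChange ℂ =
      ⨆ (S : Fin (n + 1) → Finset ((F : Type) →+* ℂ)) (_ : IsHodgeWeight Θ p S),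
        U.weightSpace F Θ S (2 * p) := by
  obtain ⟨j, a, c, hinj⟩ := Literature.NumberTheory.NumberFields.exists_separating_weight_functional (F := (F : Type)) n
  choose Mi hMi using fun i => exists_isFactorAct M F Θ (j i) (a i)
  have hinj' : Function.Injective (sepVal j a c) := hinj
  exact baseChange_hodgeClassesOf_eq_iSup' M h29 h30 hMi hinj' p

/-- The weight spaces of the Hodge weights are independent (the sum in `PohlmannBasis` is direct). -/
theorem iSupIndep_weightSpace_hodge (M : U.ModelAxioms) (p : ℕ) :
    iSupIndep fun S : {S : Fin (n + 1) → Finset ((F : Type) →+* ℂ) // IsHodgeWeight Θ p S} =>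
      U.weightSpace F Θ S.1 (2 * p) :=
  (iSupIndep_weightSpace M (2 * p)).comp Subtype.val_injective

end Print

/-- **Pohlmann's theorem in print form holds** under the model axioms M1–M28 and the weight-space facts M29/M30. -/
theorem pohlmannBasis_holds (M : U.ModelAxioms) (h29 : U.Fact_weightSpan) (h30 : U.Fact_weightHodge) :
    U.PohlmannBasis :=
  fun _F _hG _n _Θ p => baseChange_hodgeClassesOf_eq_iSup M h29 h30 p

/-- **Pohlmann's theorem in print form holds** under the model axioms M1–M28 and the four textbook facts N1–N4
(M29 := `weightSpan_of_facts`, M30 := `weightHodge_of_facts`). -/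
theorem pohlmannBasis_of_facts (M : U.ModelAxioms) (hN1 : U.Fact_cupExterior) (hN2 : U.Fact_cup_hodge)
    (hN3 : U.Fact_pull_H0) (hN4 : U.Fact_hodge_F0) : U.PohlmannBasis :=
  pohlmannBasis_holds M (weightSpan_of_facts M hN1 hN3) (weightHodge_of_facts M hN1 hN2 hN3 hN4)

/-- The print form refines the landed one: `PohlmannBasis → PohlmannSpan` (pure logic, no model axioms). -/
theorem pohlmannSpan_of_pohlmannBasis (h : U.PohlmannBasis) : U.PohlmannSpan := by
  intro F hG _h6 n Θ p
  rw [Submodule.map_le_iff_le_comap]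
  intro b hb
  rw [Submodule.mem_comap, Submodule.restrictScalars_mem]
  have hbC : ofRat b ∈ (U.hodgeClassesOf (U.cmProd F Θ) p).baseChange ℂ :=
    Submodule.tmul_mem_baseChange_of_mem 1 hb
  rw [h F hG n Θ p] at hbC
  have hle : (⨆ (S : Fin (n + 1) → Finset ((F : Type) →+* ℂ)) (_ : IsHodgeWeight Θ p S),
      U.weightSpace F Θ S (2 * p)) ≤
      Submodule.span ℂ {x : U.CohC (U.cmProd F Θ) (2 * p) |
        ∃ S : Fin (n + 1) → Finset ((F : Type) →+* ℂ), IsHodgeWeight Θ p S ∧ U.IsWeightVector F Θ S (2 * p) x} :=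
    iSup₂_le fun S hS x hx => Submodule.subset_span ⟨S, hS, (U.mem_weightSpace_iff F Θ S (2 * p) x).1 hx⟩
  exact hle hbC

end Universe

end Summit.HodgeConjecture.CorCM

end
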